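import Literature.NumberTheory.Automorphic.JordanZassenhaus
import HarnessLib

/-!
# The Brandt module of level `(N⁺, N⁻)`: Eichler orders, right-ideal classes and Brandt
# matrices of a definite quaternion algebra over `ℚ`

Let `N⁺, N⁻ ≥ 1` be coprime integers with `N⁻` squarefree with an odd number of prime factors,
`B` the (unique up to isomorphism) definite quaternion algebra over `ℚ` of discriminant `N⁻` —
ramified exactly at the primes dividing `N⁻` and at `∞` — and `O ⊆ B` an Eichler order of level
`N⁺`. The **Brandt module** of level `(N⁺, N⁻)` is the free `ℤ`-module `ℤ[Cls O]` on the finite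
set `Cls O` of classes of invertible right `O`-ideals `I` (modulo `I ∼ b I`, `b ∈ Bˣ`), together
with

* the weights `w_i = |O_ℓ(I_i)ˣ| / 2` (`O_ℓ(I_i)` the left order of a representative `I_i`), and
* the Brandt matrices `B(n) ∈ M_h(ℤ)`, `h = #Cls O`:
  `B(n)_{ij} = #{M ⊆ I_i : M an invertible right O-ideal, [I_i : M] = n², M ∼ I_j}`
  (the sub-ideals of `I_i` of reduced norm `n · nrd(I_i)` in the class of `I_j`).

(Vignéras, LNM 800, Ch. I §4, Ch. III §5 and exercise III.5.8; Eichler, LNM 320 (1973), Ch. II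
§6; Gross, *Heights and the special values of L-series* (1987), §§1–2; Pizer, J. Algebra 64
(1980), §2.) This is the wanted definition `brandtModule` of route `ABC/DefiniteXi`.

## Contents

Everything below is a real definition; the theorems are proved; the existence of Eichler packages
and the four classical properties of Brandt matrices at the end are NAMED FACTS
(`def … : Prop`, cited, not yet proved here).

* `leftOrderOf I`, `rightOrderOf I` — the left and right orders `O_ℓ(I) = {x | x I ⊆ I}`,
  `O_r(I) = {x | I x ⊆ I}` of a `ℤ`-lattice `I ⊆ B` (as `ℤ`-submodules), Vignéras I §4.
* `IsZOrder O` (a full `ℤ`-lattice containing `1` and closed under products — an *order*,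
  Vignéras I §4 Déf.), `IsMaximalZOrder O`, and `IsEichlerOrder O N`: `O = O₁ ∩ O₂` for two
  maximal orders with `[O₁ : O] = N` (an *Eichler order of level `N`*; Vignéras I §4, II §2 Déf.,
  III §5 Déf.; over `ℤ` the level is an integer and equals the index of `O` in either maximal
  order containing it, the reduced discriminant being `N · disc B`, Vignéras III §5 after Cor. 5.3).
* `IsInvertibleRightIdeal O I` — `I` is a full lattice with right order exactly `O` admitting a
  two-sided inverse `I'` (`I I' = O_ℓ(I)`, `I' I = O`); `invertibleRightIdeals O`,
  `rightIdealSetoid O` (`I ∼ J ↔ J = b • I`, `b ∈ Bˣ`), `RightIdealClass O = Cls O`.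
  **Proved**: `RightIdealClass.finite` — `Cls O` is finite for every `ℤ`-order in a quaternion
  algebra over `ℚ`, from the Jordan–Zassenhaus theorem of the tree
  (`hasFiniteClassSet_of_isQuaternionAlgebra`).
* `BrandtData` — the shape requested by the route: a finite index type `ι`, weights `w : ι → ℕ`
  and matrices `T : ℕ → Matrix ι ι ℤ`; with `BrandtData.pairing` (`⟨e_i, e_j⟩ = w_i δ_ij`),
  `BrandtData.hecke n` (Gross's correspondence `t_n`, `t_n e_i = ∑_j T(n)_ij e_j`),
  `BrandtData.classNumber`, `BrandtData.empty` (the junk value).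
* `BrandtData.ofOrder O hO` — the Brandt data of a `ℤ`-order `O` in a quaternion algebra over
  `ℚ`: `ι = Cls O`, `w i = |Stab_{Bˣ}(I_i)| / 2 = |O_ℓ(I_i)ˣ| / 2`
  (`mem_stabilizer_submodule_iff`), `T n i j` as displayed above, computed on the representatives
  `I_i = RightIdealClass.rep i`. **Proved**: `BrandtData.ofOrder_T_one` (`B(1) = 1`), and the
  independence of the representatives: `IsInvertibleRightIdeal.units_smul`,
  `subidealCount_units_smul`, `card_stabilizer_units_smul`, hence `BrandtData.ofOrder_T_mk` and
  `BrandtData.ofOrder_w_mk` (`T` and `w` may be computed on any ideal of the class).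
* `EichlerPackage N⁺ N⁻` — a definite quaternion algebra `B` over `ℚ` ramified exactly at the
  primes dividing `N⁻`, with an Eichler order of level `N⁺`; `EichlerPackage.brandtData`.
* `brandtModule N⁺ N⁻ : BrandtData` — **the Brandt module of level `(N⁺, N⁻)`**: the Brandt data
  of *some* Eichler package (chosen by `Classical.choice`), and `BrandtData.empty` if there is
  none (e.g. `ω(N⁻)` even, or `gcd(N⁺, N⁻) > 1`). Independence of the choices up to isomorphism
  of Brandt data (all Eichler orders of the same level are locally conjugate and the class set
  depends only on the level, Vignéras III §5 Cor. 5.5 ff.) is a theorem to be supplied, not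
  built into the definition; `brandtModule_eq` exposes the chosen package.
* Named facts (statements as printed, hypotheses complete): `nonempty_eichlerPackage` (existence
  at admissible levels, Vignéras III Thm. 3.1, I Prop. 4.2, II §2, III Prop. 5.1 — the
  non-vacuity of `brandtModule`), `brandtModule_massFormula` (Eichler's mass formula, Vignéras
  V §2 Cor. 2.3), `brandtMatrix_mul_of_coprime` (Vignéras III ex. 5.8 (c), any level) and
  `brandtMatrix_comm` (for `m, n` prime to `N⁺N⁻` only: Vignéras III ex. 5.8 (c)–(d), Eichler
  1973 II §6 Thm. 2 (18)–(19)), `brandtMatrix_weight_symm` (`w_j B(n)_ij = w_i B(n)_ji`, Eichler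
  1973 II §6 Thm. 2 (17)).

## Conventions and design

* Orders and ideals are `ℤ`-submodules of `B` (not subrings), to match `IsFullLattice` and the
  Jordan–Zassenhaus theorem of `JordanZassenhaus.lean`; `Bˣ` acts on `Submodule ℤ B` by left
  multiplication (Mathlib's pointwise action, locale `Pointwise`).
* Right ideals, left multiplication by `Bˣ`, left orders for the weights: the convention of
  Gross 1987 and Pollack–Weston 2011; Vignéras (III ex. 5.8) and Eichler (1973, II §6 (14)–(15))
  print the mirror image (left ideals), which changes nothing in the statements vendored here.
* `T n i j` counts sub-ideals of the *row* ideal `I_i` lying in the *column* class `j`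
  ("`B_ij(n)`"). Gross's Hecke correspondence on `ℤ[Cls O]` is `t_n e_i = ∑_j T(n)_ij e_j`
  (`BrandtData.hecke`, i.e. the matrix `(T n)ᵀ` on coordinate vectors); it is self-adjoint for
  `BrandtData.pairing` exactly when `w_j T(n)_ij = w_i T(n)_ji` (`brandtMatrix_weight_symm`). The
  action `v ↦ T(n) v` on functions `Cls O → ℤ` (algebraic modular forms) is the adjoint one.
* `[I_i : M] = n²` replaces "`nrd(M) = n · nrd(I_i)`" (equivalent for lattices in a quaternion
  algebra over `ℚ`: `[I : M] = (nrd M / nrd I)²`), so no reduced norm of lattices is needed.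
* Junk values (documented at each definition): `w i = 0` if the unit group is infinite (never for
  `B` definite), `Nat.card = 0` for infinite sets, `brandtModule = BrandtData.empty` if no
  Eichler package exists.
* What is NOT here: the adelic description `Cls O ≅ Bˣ \ B̂ˣ / Ôˣ` and the identification of
  `ℤ[Cls O]`-valued functions with `QuaternionicForm B Ôˣ ℤ` of `QuaternionicForms.lean`; the
  Jacquet–Langlands / Eichler basis-problem comparison with `S₂(Γ₀(N⁺N⁻))^{N⁻-new}`; existence of
  Eichler packages (the quaternion algebra exists by `exists_isQuaternionAlgebra_of_even_rat`;
  maximal and Eichler orders of every level exist, Vignéras I Prop. 4.2, II §2) — all left to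
  follow-up items.

## Mathlib / tree searches

`lean search` for `Brandt`, `Eichler order`, `eichlerOrder`, `maximalOrder`, `IsMaximalOrder`,
`IdealClass` in this sense: nothing in Mathlib or the tree (2026-08-15). Used from the tree:
`IsFullLattice`, `HasFiniteClassSet`, `hasFiniteClassSet_of_isQuaternionAlgebra`,
`mem_units_smul_submodule_iff` (`JordanZassenhaus.lean`), `IsQuaternionAlgebra`,
`IsTotallyDefinite`, `ramifiedPlaces` (`QuaternionAlgebraAdelic.lean`).
-/

noncomputable section

open scoped Pointwise Matrix
open NumberField IsDedekindDomain

universe u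

namespace Literature.NumberTheory.Automorphic

/-! ### Left and right orders of a lattice; `ℤ`-orders, maximal orders, Eichler orders -/

section Orders

variable {B : Type u} [Ring B]

/-- The **left order** `O_ℓ(I) = {x ∈ B | x I ⊆ I}` of a `ℤ`-lattice `I ⊆ B`, as a `ℤ`-submodule
(it contains `1` and is closed under products: `one_mem_leftOrderOf`, `mul_mem_leftOrderOf`).
Vignéras, LNM 800, Ch. I §4, p. 20 ("ordre à gauche"). [cite: VignerasLNM800, Ch. I §4 Déf. p. 20 (ordre à gauche)] -/
def leftOrderOf (I : Submodule ℤ B) : Submodule ℤ B where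
  carrier := {x | ∀ y ∈ I, x * y ∈ I}
  add_mem' {a b} ha hb y hy := by
    rw [add_mul]
    exact add_mem (ha y hy) (hb y hy)
  zero_mem' y _ := by
    rw [zero_mul]
    exact zero_mem _
  smul_mem' n {x} hx y hy := by
    rw [smul_mul_assoc]
    exact I.smul_mem n (hx y hy)

/-- The **right order** `O_r(I) = {x ∈ B | I x ⊆ I}` of a `ℤ`-lattice `I ⊆ B`, as a
`ℤ`-submodule. Vignéras, LNM 800, Ch. I §4, p. 20 ("ordre à droite"). [cite: VignerasLNM800, Ch. I §4 Déf. p. 20 (ordre à droite)] -/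
def rightOrderOf (I : Submodule ℤ B) : Submodule ℤ B where
  carrier := {x | ∀ y ∈ I, y * x ∈ I}
  add_mem' {a b} ha hb y hy := by
    rw [mul_add]
    exact add_mem (ha y hy) (hb y hy)
  zero_mem' y _ := by
    rw [mul_zero]
    exact zero_mem _
  smul_mem' n {x} hx y hy := by
    rw [mul_smul_comm]
    exact I.smul_mem n (hx y hy)

/-- `x ∈ O_ℓ(I) ↔ x I ⊆ I` (definitional). [folklore] -/
@[simp] theorem mem_leftOrderOf_iff {I : Submodule ℤ B} {x : B} :
    x ∈ leftOrderOf I ↔ ∀ y ∈ I, x * y ∈ I := Iff.rfl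

/-- `x ∈ O_r(I) ↔ I x ⊆ I` (definitional). [folklore] -/
@[simp] theorem mem_rightOrderOf_iff {I : Submodule ℤ B} {x : B} :
    x ∈ rightOrderOf I ↔ ∀ y ∈ I, y * x ∈ I := Iff.rfl

/-- `1 ∈ O_ℓ(I)`. [folklore] -/
theorem one_mem_leftOrderOf (I : Submodule ℤ B) : (1 : B) ∈ leftOrderOf I := fun y hy => by
  rwa [one_mul]

/-- `O_ℓ(I)` is closed under multiplication. [folklore] -/
theorem mul_mem_leftOrderOf {I : Submodule ℤ B} {a b : B} (ha : a ∈ leftOrderOf I)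
    (hb : b ∈ leftOrderOf I) : a * b ∈ leftOrderOf I := fun y hy => by
  rw [mul_assoc]
  exact ha _ (hb y hy)

/-- `1 ∈ O_r(I)`. [folklore] -/
theorem one_mem_rightOrderOf (I : Submodule ℤ B) : (1 : B) ∈ rightOrderOf I := fun y hy => by
  rwa [mul_one]

/-- `O_r(I)` is closed under multiplication. [folklore] -/
theorem mul_mem_rightOrderOf {I : Submodule ℤ B} {a b : B} (ha : a ∈ rightOrderOf I)
    (hb : b ∈ rightOrderOf I) : a * b ∈ rightOrderOf I := fun y hy => by
  rw [← mul_assoc]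
  exact hb _ (ha y hy)

/-- A **`ℤ`-order** in the ring `B`: a full `ℤ`-lattice (`IsFullLattice`: finitely generated with
`ℚ O = B`) containing `1` and closed under multiplication — Vignéras' "ordre": "un idéal qui est
un anneau" (LNM 800, Ch. I §4 Déf., p. 20), specialised to `R = ℤ`; the same three hypotheses
`h1, hmul, hΛ` under which the tree's Jordan–Zassenhaus theorem is stated. [cite: VignerasLNM800, Ch. I §4 Déf. p. 20 (ordre)] -/
structure IsZOrder (O : Submodule ℤ B) : Prop where
  /-- `1 ∈ O`. -/
  one_mem : (1 : B) ∈ O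
  /-- `O` is closed under multiplication. -/
  mul_mem : ∀ a ∈ O, ∀ b ∈ O, a * b ∈ O
  /-- `O` is a full `ℤ`-lattice in `B`. -/
  isFullLattice : IsFullLattice B O

/-- A **maximal order**: a `ℤ`-order not properly contained in another one (Vignéras I §4 Déf.,
p. 20: "un ordre qui n'est pas contenu dans un autre ordre, distinct de lui-même"). [cite: VignerasLNM800, Ch. I §4 Déf. p. 20 (ordre maximal)] -/
def IsMaximalZOrder (O : Submodule ℤ B) : Prop :=
  IsZOrder O ∧ ∀ O' : Submodule ℤ B, IsZOrder O' → O ≤ O' → O' = O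

/-- An **Eichler order of level `N`** (`N ≥ 1` an integer): the intersection `O = O₁ ∩ O₂` of two
maximal orders, of index `[O₁ : O] = N` in the first. Vignéras I §4 Déf. p. 20 ("un ordre
d'Eichler est l'intersection de deux ordres maximaux"); the level is defined locally (II §2 Déf.:
at a split prime an Eichler order of level `p^n` is the intersection of two maximal orders at
distance `n`, conjugate to `(ℤ_p, ℤ_p; p^n ℤ_p, ℤ_p)`, of index `p^n` in `M₂(ℤ_p)`; at a ramified
prime it is the maximal order) and globally as the ideal `N` with those local components
(III §5 Déf.), so that over `ℤ` the level is the integer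
`∏ p^{n_p} = [O₁ : O]` and the reduced discriminant of `O` is `N · disc B` (III §5, after
Cor. 5.3). The index is taken in `O₁`; it is the same in `O₂` and in every maximal order
containing `O` (all maximal orders have the same discriminant), a fact not used here. [cite: VignerasLNM800, Ch. I §4 Déf. p. 20, Ch. II §2 Déf. (niveau), Ch. III §5 Déf. (niveau)] -/
def IsEichlerOrder (O : Submodule ℤ B) (N : ℕ) : Prop :=
  ∃ O₁ O₂ : Submodule ℤ B, IsMaximalZOrder O₁ ∧ IsMaximalZOrder O₂ ∧ O = O₁ ⊓ O₂ ∧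
    O.toAddSubgroup.relIndex O₁.toAddSubgroup = N

/-- The intersection of two `ℤ`-orders is a `ℤ`-order. [folklore] -/
theorem IsZOrder.inf {O₁ O₂ : Submodule ℤ B} (h₁ : IsZOrder O₁) (h₂ : IsZOrder O₂) :
    IsZOrder (O₁ ⊓ O₂) where
  one_mem := ⟨h₁.one_mem, h₂.one_mem⟩
  mul_mem a ha b hb := ⟨h₁.mul_mem a ha.1 b hb.1, h₂.mul_mem a ha.2 b hb.2⟩
  isFullLattice := by
    refine ⟨Submodule.FG.of_le h₁.isFullLattice.1 inf_le_left, fun d => ?_⟩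
    obtain ⟨m, hm, hmd⟩ := h₁.isFullLattice.2 d
    obtain ⟨n, hn, hnd⟩ := h₂.isFullLattice.2 d
    refine ⟨n * m, mul_ne_zero hn hm, ?_, ?_⟩
    · rw [mul_smul]
      exact O₁.smul_mem n hmd
    · rw [mul_comm, mul_smul]
      exact O₂.smul_mem m hnd

/-- An Eichler order is a `ℤ`-order. [folklore] -/
theorem IsEichlerOrder.isZOrder {O : Submodule ℤ B} {N : ℕ} (h : IsEichlerOrder O N) :
    IsZOrder O := by
  obtain ⟨O₁, O₂, h₁, h₂, rfl, -⟩ := h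
  exact h₁.1.inf h₂.1

/-- A maximal order is an Eichler order of level `1` (`O = O ∩ O`). [folklore] -/
theorem IsMaximalZOrder.isEichlerOrder_one {O : Submodule ℤ B} (h : IsMaximalZOrder O) :
    IsEichlerOrder O 1 :=
  ⟨O, O, h, h, (inf_idem O).symm, AddSubgroup.relIndex_self _⟩

end Orders

/-! ### Invertible right ideals and their classes -/

section Ideals

variable {B : Type u} [Ring B]

/-- An **invertible right `O`-ideal** (a "right fractional `O`-ideal, invertible", Vignéras I §4
pp. 20–21: "idéal … à droite de `O_d`", "inverse", and the rules `I I⁻¹ = O_g`, `I⁻¹ I = O_d`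
assumed there "désormais"): a full `ℤ`-lattice `I ⊆ B` whose right order is exactly `O` and which
has a two-sided inverse — a lattice `I'` with `I I' = O_ℓ(I)` and `I' I = O`. For Eichler orders
these are exactly the locally principal right `O`-ideals, the ideals Vignéras works with from
III §5 B on ("les idéaux seront principaux localement"). [cite: VignerasLNM800, Ch. I §4 pp. 20–21 (idéal à droite, inverse), Ch. III §5 B] -/
structure IsInvertibleRightIdeal (O I : Submodule ℤ B) : Prop where
  /-- `I` is a full `ℤ`-lattice in `B`. -/
  isFullLattice : IsFullLattice B I
  /-- The right order of `I` is exactly `O`. -/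
  rightOrderOf_eq : rightOrderOf I = O
  /-- `I` has a two-sided inverse lattice. -/
  exists_inv : ∃ I' : Submodule ℤ B, I * I' = leftOrderOf I ∧ I' * I = O

/-- An invertible right `O`-ideal is stable under right multiplication by `O`. [folklore] -/
theorem IsInvertibleRightIdeal.mul_mem {O I : Submodule ℤ B} (h : IsInvertibleRightIdeal O I)
    {m : B} (hm : m ∈ I) {a : B} (ha : a ∈ O) : m * a ∈ I := by
  rw [← h.rightOrderOf_eq] at ha
  exact ha m hm

variable (O : Submodule ℤ B)

/-- The set of invertible right `O`-ideals. [folklore] -/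
def invertibleRightIdeals : Set (Submodule ℤ B) := {I | IsInvertibleRightIdeal O I}

/-- `I ∈ invertibleRightIdeals O ↔ IsInvertibleRightIdeal O I` (definitional). [folklore] -/
@[simp] theorem mem_invertibleRightIdeals_iff {I : Submodule ℤ B} :
    I ∈ invertibleRightIdeals O ↔ IsInvertibleRightIdeal O I := Iff.rfl

/-- **Equivalence of right ideals**: `I ∼ J` iff `J = b I` for some `b ∈ Bˣ` (left multiplication
by units of `B`; Vignéras I §4 / III §5 B: classes of left ideals modulo right multiplication,
mirrored). [cite: VignerasLNM800, Ch. III §5 B (classes d'idéaux)] -/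
def rightIdealSetoid : Setoid (invertibleRightIdeals O) where
  r I J := ∃ b : Bˣ, (J : Submodule ℤ B) = b • (I : Submodule ℤ B)
  iseqv :=
    { refl := fun I => ⟨1, (one_smul _ _).symm⟩
      symm := fun {I J} ⟨b, hb⟩ => ⟨b⁻¹, by rw [hb, inv_smul_smul]⟩
      trans := fun {I J K} ⟨b, hb⟩ ⟨c, hc⟩ => ⟨c * b, by rw [hc, hb, mul_smul]⟩ }

/-- The **right class set** `Cls O`: invertible right `O`-ideals modulo `I ∼ b I` (`b ∈ Bˣ`).
Its cardinality is the class number of `O` (Vignéras III §5 B, "nombre de classes des idéaux";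
finite: `RightIdealClass.finite`). [cite: VignerasLNM800, Ch. III §5 B and Thm. 5.4] -/
abbrev RightIdealClass : Type u := Quotient (rightIdealSetoid O)

namespace RightIdealClass

variable {O}

/-- The class `[I] ∈ Cls O` of an invertible right `O`-ideal. [folklore] -/
def mk (I : invertibleRightIdeals O) : RightIdealClass O := Quotient.mk (rightIdealSetoid O) I

/-- `[I] = [J] ↔ J = b I` for some `b ∈ Bˣ`. [folklore] -/
theorem mk_eq_mk_iff {I J : invertibleRightIdeals O} :
    mk I = mk J ↔ ∃ b : Bˣ, (J : Submodule ℤ B) = b • (I : Submodule ℤ B) :=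
  Quotient.eq (r := rightIdealSetoid O)

/-- Every class is the class of an ideal. [folklore] -/
theorem mk_surjective : Function.Surjective (mk : invertibleRightIdeals O → RightIdealClass O) :=
  Quotient.mk_surjective

/-- A chosen representative `I_i` of the class `i ∈ Cls O` (by choice; every statement vendored
below is independent of it). [folklore] -/
def rep (i : RightIdealClass O) : Submodule ℤ B := ((Quotient.out i : invertibleRightIdeals O) :)

/-- The representative of a class is an invertible right `O`-ideal. [folklore] -/
theorem isInvertibleRightIdeal_rep (i : RightIdealClass O) : IsInvertibleRightIdeal O (rep i) :=
  (Quotient.out i : invertibleRightIdeals O).2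

/-- The class of the representative of `i` is `i`. [folklore] -/
@[simp] theorem mk_rep (i : RightIdealClass O) : mk ⟨rep i, isInvertibleRightIdeal_rep i⟩ = i :=
  Quotient.out_eq i

/-- **Finiteness of the class number** (Vignéras III §5 Thm. 5.4; here for `ℤ`-orders in a
quaternion algebra over `ℚ`, PROVED from the Jordan–Zassenhaus theorem of the tree,
`hasFiniteClassSet_of_isQuaternionAlgebra`: every full right `O`-lattice is `d⁻¹ M'` with `M'` in
a finite set). [cite: VignerasLNM800, Ch. III §5 Thm. 5.4] -/
theorem finite {B : Type u} [Ring B] [Algebra ℚ B] [IsQuaternionAlgebra ℚ B] {O : Submodule ℤ B}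
    (hO : IsZOrder O) : Finite (RightIdealClass O) := by
  classical
  obtain ⟨T, hT⟩ :=
    hasFiniteClassSet_of_isQuaternionAlgebra ℚ B O hO.one_mem hO.mul_mem hO.isFullLattice
  have key : ∀ I : invertibleRightIdeals O, ∃ d : Bˣ, d • (I : Submodule ℤ B) ∈ T := fun I =>
    hT I I.2.isFullLattice fun m hm a ha => I.2.mul_mem hm ha
  choose d hd using key
  let f : RightIdealClass O → T := fun i =>
    ⟨d (Quotient.out i) • ((Quotient.out i : invertibleRightIdeals O) : Submodule ℤ B), hd _⟩
  refine Finite.of_injective f fun i j hij => ?_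
  have h : d (Quotient.out i) • ((Quotient.out i : invertibleRightIdeals O) : Submodule ℤ B) =
      d (Quotient.out j) • ((Quotient.out j : invertibleRightIdeals O) : Submodule ℤ B) :=
    congrArg Subtype.val hij
  rw [← Quotient.out_eq i, ← Quotient.out_eq j]
  refine Quotient.sound ⟨(d (Quotient.out j))⁻¹ * d (Quotient.out i), ?_⟩
  rw [mul_smul, h, inv_smul_smul]

end RightIdealClass

/-- The stabiliser of a lattice `I` under left multiplication by `Bˣ` is the unit group of its
left order: `u I = I ↔ u ∈ O_ℓ(I) ∧ u⁻¹ ∈ O_ℓ(I)`. This identifies the weights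
`w_i = |Stab(I_i)| / 2` of `BrandtData.ofOrder` with `|O_ℓ(I_i)ˣ| / 2`. [folklore] -/
theorem mem_stabilizer_submodule_iff {I : Submodule ℤ B} {u : Bˣ} :
    u ∈ MulAction.stabilizer Bˣ I ↔
      (u : B) ∈ leftOrderOf I ∧ ((u⁻¹ : Bˣ) : B) ∈ leftOrderOf I := by
  rw [MulAction.mem_stabilizer_iff]
  constructor
  · intro h
    refine ⟨fun y hy => ?_, fun y hy => ?_⟩
    · rw [← h]
      exact Submodule.smul_mem_pointwise_smul y u I hy
    · rw [← smul_eq_mul, ← Units.smul_def, ← mem_units_smul_submodule_iff, h]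
      exact hy
  · rintro ⟨hu, hu'⟩
    apply le_antisymm
    · intro x hx
      obtain ⟨y, hy, rfl⟩ := (Submodule.mem_smul_pointwise_iff_exists x u I).mp hx
      exact hu y hy
    · intro x hx
      rw [mem_units_smul_submodule_iff, Units.smul_def, smul_eq_mul]
      exact hu' x hx

end Ideals

/-! ### Brandt data -/

/-- **Brandt data**: a finite index set `ι` (the class set), weights `w : ι → ℕ` and a family of
integer matrices `T n ∈ M_ι(ℤ)` (the Brandt matrices) — the shape in which route `ABC/DefiniteXi`
consumes the Brandt module (`ℤ[ι]` with `⟨e_i, e_j⟩ = w_i δ_ij` and the Hecke action of the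
`T n`). Gross 1987 §1; Pizer 1980 §2. [folklore] -/
structure BrandtData : Type (u + 1) where
  /-- The index set (class set `Cls O`). -/
  ι : Type u
  /-- `ι` is finite. -/
  [instFintype : Fintype ι]
  /-- `ι` has decidable equality. -/
  [instDecidableEq : DecidableEq ι]
  /-- The weights `w_i = |O_ℓ(I_i)ˣ| / 2`. -/
  w : ι → ℕ
  /-- The Brandt matrices `T n = B(n)`. -/
  T : ℕ → Matrix ι ι ℤ

namespace BrandtData

/-- The index set of Brandt data is a finite type (the bundled instance, re-exposed). [folklore] -/
instance instFintypeι (M : BrandtData.{u}) : Fintype M.ι := M.instFintype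

/-- The index set of Brandt data has decidable equality (the bundled instance, re-exposed). [folklore] -/
instance instDecidableEqι (M : BrandtData.{u}) : DecidableEq M.ι := M.instDecidableEq

/-- The **class number** `h = #ι` of Brandt data (the rank of the Brandt module `ℤ[ι]`). [folklore] -/
def classNumber (M : BrandtData.{u}) : ℕ := Fintype.card M.ι

/-- The **height pairing** on the Brandt module `ℤ[ι]` (as coordinate vectors `ι → ℤ`):
`⟨v, v'⟩ = ∑_i w_i v_i v'_i`, i.e. `⟨e_i, e_j⟩ = w_i δ_ij` (Gross 1987: the basis `e_i` of
`Pic(X)` with `⟨e_i, e_i⟩ = w_i`; Pollack–Weston 2011 §2: `ξ_f(N⁺, N⁻) = ⟨φ_f, φ_f⟩`). [folklore] -/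
def pairing (M : BrandtData.{u}) (v v' : M.ι → ℤ) : ℤ := ∑ i, (M.w i : ℤ) * v i * v' i

/-- The **Hecke correspondence** `t_n` on the Brandt module `ℤ[ι]`, `t_n e_i = ∑_j T(n)_ij e_j`,
written on coordinate vectors: `(t_n v)_j = ∑_i T(n)_ij v_i`, i.e. multiplication by the
transpose `(T n)ᵀ` (Gross 1987 §4: the correspondence sending the class of `I_i` to the sum of the
classes of its sub-ideals of reduced norm `n · nrd I_i`). The action `v ↦ T(n) v` on functions
`ι → ℤ` is its adjoint. [folklore] -/
def hecke (M : BrandtData.{u}) (n : ℕ) : (M.ι → ℤ) →ₗ[ℤ] (M.ι → ℤ) :=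
  Matrix.mulVecLin (M.T n)ᵀ

/-- `hecke M n v = (T n)ᵀ v` (definitional). [folklore] -/
theorem hecke_apply (M : BrandtData.{u}) (n : ℕ) (v : M.ι → ℤ) :
    M.hecke n v = Matrix.mulVec (M.T n)ᵀ v := rfl

/-- The **empty Brandt data** (`ι = Fin 0`): the documented junk value of `brandtModule` at
inadmissible levels. [folklore] -/
def empty : BrandtData.{0} where
  ι := Fin 0
  w := Fin.elim0
  T _ := 0

/-- The empty Brandt data has class number `0`. [folklore] -/
@[simp] theorem classNumber_empty : empty.classNumber = 0 := rfl

end BrandtData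

/-! ### The Brandt data of an order -/

section OfOrder

variable {B : Type u} [Ring B] [Algebra ℚ B] [IsQuaternionAlgebra ℚ B]

/-- The number of invertible right `O`-ideals `M ⊆ I` of index `[I : M] = n²` (i.e. of reduced
norm `n · nrd I`) lying in the class `j ∈ Cls O` — the Brandt-matrix entry `B_{[I] j}(n)` computed
on the ideal `I` (Eichler 1973, II §6 (14)–(15) with `l = 0`; Vignéras III ex. 5.8, mirrored to
right ideals). `Nat.card`, hence `0` if the set were infinite (it is finite: finitely many
subgroups of index `n²` in a finitely generated group). [cite: Eichler1973, Ch. II §6 (14)–(15)] -/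
def subidealCount (O : Submodule ℤ B) (I : Submodule ℤ B) (n : ℕ) (j : RightIdealClass O) : ℕ :=
  Nat.card {M : invertibleRightIdeals O //
    (M : Submodule ℤ B) ≤ I ∧
      (M : Submodule ℤ B).toAddSubgroup.relIndex I.toAddSubgroup = n ^ 2 ∧
        RightIdealClass.mk M = j}

/-- **The Brandt data of a `ℤ`-order `O`** in a quaternion algebra `B` over `ℚ`:
* `ι = Cls O`, the (finite, `RightIdealClass.finite`) right class set, with representatives
  `I_i = RightIdealClass.rep i`;
* `w i = |Stab_{Bˣ}(I_i)| / 2 = |O_ℓ(I_i)ˣ| / 2` (`mem_stabilizer_submodule_iff`; Gross 1987 §1,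
  Vignéras V §2 Cor. 2.3: `w_i = [O_iˣ : ℤˣ]`; `Nat.card`, so `0` if the unit group is infinite,
  which does not happen for `B` definite);
* `T n i j = #{M ⊆ I_i invertible right O-ideal : [I_i : M] = n², [M] = j}` (`subidealCount`),
  the Brandt matrix `B(n)` (Eichler 1973 II §6 (15), `l = 0`; Vignéras III ex. 5.8; Pizer 1980
  §2; Gross 1987 §1).
All three are independent of the representatives up to the evident relabelling (left
multiplication by `b ∈ Bˣ` transports sub-ideals, indices, classes and conjugates stabilisers);
this is not needed to state the data and is not proved here. [cite: Eichler1973, Ch. II §6 (14)–(15) and Thm. 2] -/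
def BrandtData.ofOrder (O : Submodule ℤ B) (hO : IsZOrder O) : BrandtData.{u} :=
  letI : Fintype (RightIdealClass O) := @Fintype.ofFinite _ (RightIdealClass.finite hO)
  letI : DecidableEq (RightIdealClass O) := Classical.decEq _
  { ι := RightIdealClass O
    w := fun i => Nat.card (MulAction.stabilizer Bˣ (RightIdealClass.rep i)) / 2
    T := fun n => Matrix.of fun i j => (subidealCount O (RightIdealClass.rep i) n j : ℤ) }

/-- The index type of `BrandtData.ofOrder O` is the class set `Cls O` (definitional). [folklore] -/
@[simp] theorem BrandtData.ofOrder_ι (O : Submodule ℤ B) (hO : IsZOrder O) :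
    (BrandtData.ofOrder O hO).ι = RightIdealClass O := rfl

/-- The weights of `BrandtData.ofOrder O`: `w i = |Stab_{Bˣ}(I_i)| / 2` (definitional). [folklore] -/
theorem BrandtData.ofOrder_w (O : Submodule ℤ B) (hO : IsZOrder O) (i : RightIdealClass O) :
    (BrandtData.ofOrder O hO).w i =
      Nat.card (MulAction.stabilizer Bˣ (RightIdealClass.rep i)) / 2 := rfl

/-- The Brandt matrices of `BrandtData.ofOrder O`: `T n i j = subidealCount O I_i n j`
(definitional). [folklore] -/
theorem BrandtData.ofOrder_T (O : Submodule ℤ B) (hO : IsZOrder O) (n : ℕ)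
    (i j : RightIdealClass O) :
    (BrandtData.ofOrder O hO).T n i j = subidealCount O (RightIdealClass.rep i) n j := rfl

/-- The entries of Brandt matrices are natural numbers (counts). [folklore] -/
theorem BrandtData.ofOrder_T_nonneg (O : Submodule ℤ B) (hO : IsZOrder O) (n : ℕ)
    (i j : RightIdealClass O) : 0 ≤ (BrandtData.ofOrder O hO).T n i j := by
  rw [BrandtData.ofOrder_T]
  exact Int.natCast_nonneg _

omit [Algebra ℚ B] [IsQuaternionAlgebra ℚ B] in
/-- The only sub-ideal of `I_i` of index `1` is `I_i` itself, of class `i`: the count behind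
`B(1) = 1`. [folklore] -/
theorem subidealCount_rep_one (O : Submodule ℤ B) [DecidableEq (RightIdealClass O)]
    (i j : RightIdealClass O) :
    subidealCount O (RightIdealClass.rep i) 1 j = if i = j then 1 else 0 := by
  have key : ∀ M : invertibleRightIdeals O,
      ((M : Submodule ℤ B) ≤ RightIdealClass.rep i ∧
        (M : Submodule ℤ B).toAddSubgroup.relIndex (RightIdealClass.rep i).toAddSubgroup = 1 ^ 2 ∧
          RightIdealClass.mk M = j) ↔
        (M : Submodule ℤ B) = RightIdealClass.rep i ∧ i = j := by
    intro M
    rw [one_pow, AddSubgroup.relIndex_eq_one]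
    constructor
    · rintro ⟨hle, hge, hj⟩
      have hM : (M : Submodule ℤ B) = RightIdealClass.rep i := le_antisymm hle fun x hx => hge hx
      refine ⟨hM, ?_⟩
      rw [← hj, ← RightIdealClass.mk_rep i]
      congr 1
      exact Subtype.ext hM.symm
    · rintro ⟨hM, rfl⟩
      refine ⟨hM.le, fun x hx => ?_, ?_⟩
      · change x ∈ (M : Submodule ℤ B)
        rw [hM]
        exact hx
      · rw [← RightIdealClass.mk_rep i]
        congr 1
        exact Subtype.ext hM
  unfold subidealCount
  split_ifs with hij
  · subst hij
    rw [Nat.card_eq_one_iff_unique]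
    refine ⟨⟨fun a b => Subtype.ext (Subtype.ext ?_)⟩,
      ⟨⟨⟨RightIdealClass.rep i, RightIdealClass.isInvertibleRightIdeal_rep i⟩,
        (key _).mpr ⟨rfl, rfl⟩⟩⟩⟩
    rw [((key a.1).mp a.2).1, ((key b.1).mp b.2).1]
  · rw [Nat.card_eq_zero]
    exact Or.inl ⟨fun a => hij ((key a.1).mp a.2).2⟩

/-- **`B(1)` is the identity matrix** (Vignéras V §3: "`P(1)` est la matrice identité"; Eichler
1973 II §6): the Brandt matrix of `1` of any `ℤ`-order, proved from the definitions. [cite: VignerasLNM800, Ch. V §3 B (P(1) est la matrice identité)] -/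
theorem BrandtData.ofOrder_T_one (O : Submodule ℤ B) (hO : IsZOrder O) :
    (BrandtData.ofOrder O hO).T 1 = 1 := by
  classical
  ext i j
  rw [BrandtData.ofOrder_T, subidealCount_rep_one, Matrix.one_apply]
  split_ifs <;> simp_all

end OfOrder

/-! ### Transport by units: the Brandt data do not depend on the representatives -/

section Transport

variable {B : Type u} [Ring B]

/-- Membership in a right translate `S c` (`c ∈ Bˣ`, acting through `Bᵐᵒᵖ`): `m ∈ S c ↔ m c⁻¹ ∈ S`.
[folklore] -/
theorem mem_op_units_smul_submodule_iff {u : Bˣ} {S : Submodule ℤ B} {m : B} :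
    m ∈ MulOpposite.op (u : B) • S ↔ m * ((u⁻¹ : Bˣ) : B) ∈ S := by
  rw [Submodule.mem_smul_pointwise_iff_exists]
  constructor
  · rintro ⟨s, hs, rfl⟩
    rwa [MulOpposite.smul_eq_mul_unop, MulOpposite.unop_op, Units.mul_inv_cancel_right]
  · intro h
    exact ⟨_, h, by rw [MulOpposite.smul_eq_mul_unop, MulOpposite.unop_op, Units.inv_mul_cancel_right]⟩

/-- The action of `b ∈ Bˣ` on lattices is the action of `b ∈ B`. [folklore] -/
theorem units_smul_submodule_eq (b : Bˣ) (N : Submodule ℤ B) : b • N = (b : B) • N := by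
  ext x
  simp only [Submodule.mem_smul_pointwise_iff_exists, Units.smul_def]

/-- `(M c) N = M (c N)` for lattices `M, N` and `c ∈ B`. [folklore] -/
theorem op_smul_mul_eq_mul_smul (c : B) (M N : Submodule ℤ B) :
    (MulOpposite.op c • M) * N = M * (c • N) := by
  apply le_antisymm
  · rw [Submodule.mul_le]
    intro m hm n hn
    obtain ⟨m', hm', rfl⟩ := (Submodule.mem_smul_pointwise_iff_exists m _ M).mp hm
    rw [MulOpposite.smul_eq_mul_unop, MulOpposite.unop_op, mul_assoc]
    exact Submodule.mul_mem_mul hm' (Submodule.smul_mem_pointwise_smul n c N hn)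
  · rw [Submodule.mul_le]
    intro m hm n hn
    obtain ⟨n', hn', rfl⟩ := (Submodule.mem_smul_pointwise_iff_exists n _ N).mp hn
    rw [smul_eq_mul, ← mul_assoc]
    exact Submodule.mul_mem_mul (Submodule.smul_mem_pointwise_smul m _ M hm) hn'

/-- The left order of a translate: `O_ℓ(b I) = b O_ℓ(I) b⁻¹`. [folklore] -/
theorem leftOrderOf_units_smul (b : Bˣ) (I : Submodule ℤ B) :
    leftOrderOf (b • I) = b • (MulOpposite.op ((b⁻¹ : Bˣ) : B) • leftOrderOf I) := by
  ext x
  rw [mem_units_smul_submodule_iff, mem_op_units_smul_submodule_iff, inv_inv, mem_leftOrderOf_iff,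
    mem_leftOrderOf_iff]
  constructor
  · intro h y hy
    have := h _ (Submodule.smul_mem_pointwise_smul y b I hy)
    rw [mem_units_smul_submodule_iff] at this
    simpa only [Units.smul_def, smul_eq_mul, mul_assoc] using this
  · intro h y hy
    rw [mem_units_smul_submodule_iff]
    have hy' : ((b⁻¹ : Bˣ) : B) * y ∈ I := by
      rw [← smul_eq_mul, ← Units.smul_def, ← mem_units_smul_submodule_iff]
      exact hy
    have := h _ hy'
    simpa only [Units.smul_def, smul_eq_mul, mul_assoc, Units.mul_inv_cancel_left] using this

/-- The right order of a translate: `O_r(b I) = O_r(I)`. [folklore] -/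
theorem rightOrderOf_units_smul (b : Bˣ) (I : Submodule ℤ B) :
    rightOrderOf (b • I) = rightOrderOf I := by
  ext x
  rw [mem_rightOrderOf_iff, mem_rightOrderOf_iff]
  constructor
  · intro h y hy
    have := h _ (Submodule.smul_mem_pointwise_smul y b I hy)
    rw [mem_units_smul_submodule_iff] at this
    simpa only [Units.smul_def, smul_eq_mul, ← mul_assoc, Units.inv_mul, one_mul,
      Units.inv_mul_cancel_left] using this
  · intro h y hy
    rw [mem_units_smul_submodule_iff] at hy ⊢
    simpa only [Units.smul_def, smul_eq_mul, mul_assoc] using h _ hy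

/-- A translate of a full lattice is a full lattice. [folklore] -/
theorem IsFullLattice.units_smul (b : Bˣ) {I : Submodule ℤ B} (hI : IsFullLattice B I) :
    IsFullLattice B (b • I) := by
  refine ⟨?_, fun d => ?_⟩
  · rw [Units.smul_def, Submodule.pointwise_smul_def]
    exact hI.1.map _
  · obtain ⟨n, hn, hnd⟩ := hI.2 ((b⁻¹ : Bˣ) • d)
    refine ⟨n, hn, ?_⟩
    rw [mem_units_smul_submodule_iff, smul_comm]
    exact hnd

/-- **Translates of invertible right ideals are invertible right ideals** (with inverse
`I' b⁻¹`). [folklore] -/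
theorem IsInvertibleRightIdeal.units_smul {O I : Submodule ℤ B} (b : Bˣ)
    (h : IsInvertibleRightIdeal O I) : IsInvertibleRightIdeal O (b • I) where
  isFullLattice := h.isFullLattice.units_smul b
  rightOrderOf_eq := by rw [rightOrderOf_units_smul, h.rightOrderOf_eq]
  exists_inv := by
    obtain ⟨I', h₁, h₂⟩ := h.exists_inv
    refine ⟨MulOpposite.op ((b⁻¹ : Bˣ) : B) • I', ?_, ?_⟩
    · rw [smul_mul_assoc, mul_smul_comm, h₁, leftOrderOf_units_smul]
    · rw [op_smul_mul_eq_mul_smul, ← units_smul_submodule_eq, inv_smul_smul, h₂]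

variable {O : Submodule ℤ B}

/-- The class of a translate: `[b I] = [I]`. [folklore] -/
theorem RightIdealClass.mk_units_smul (b : Bˣ) (I : invertibleRightIdeals O) :
    RightIdealClass.mk ⟨b • (I : Submodule ℤ B), I.2.units_smul b⟩ = RightIdealClass.mk I :=
  (RightIdealClass.mk_eq_mk_iff.mpr ⟨b, rfl⟩).symm

/-- Translation is monotone: `M ≤ N → b M ≤ b N`. [folklore] -/
theorem units_smul_mono (b : Bˣ) {M N : Submodule ℤ B} (h : M ≤ N) : b • M ≤ b • N := by
  rw [Units.smul_def, Units.smul_def, Submodule.pointwise_smul_def, Submodule.pointwise_smul_def]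
  exact Submodule.map_mono h

/-- The index of lattices is invariant under translation: `[b I : b M] = [I : M]`. [folklore] -/
theorem relIndex_units_smul (b : Bˣ) (M I : Submodule ℤ B) :
    (b • M).toAddSubgroup.relIndex (b • I).toAddSubgroup =
      M.toAddSubgroup.relIndex I.toAddSubgroup := by
  rw [Units.smul_def, Units.smul_def, Submodule.pointwise_smul_toAddSubgroup,
    Submodule.pointwise_smul_toAddSubgroup, AddSubgroup.pointwise_smul_def,
    AddSubgroup.pointwise_smul_def]
  refine AddSubgroup.relIndex_map_map_of_injective _ _ fun x y hxy => ?_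
  have hxy' : b • x = b • y := hxy
  exact MulAction.injective b hxy'

/-- **The sub-ideal counts do not depend on the representative**: `B_{[bI] j}(n)` computed on
`b I` equals `B_{[I] j}(n)` computed on `I` (`M ↦ b M` is a bijection on the sub-ideals counted).
[folklore] -/
theorem subidealCount_units_smul (b : Bˣ) (I : Submodule ℤ B) (n : ℕ) (j : RightIdealClass O) :
    subidealCount O (b • I) n j = subidealCount O I n j := by
  unfold subidealCount
  refine (Nat.card_congr ?_).symm
  refine
    { toFun := fun M => ⟨⟨b • (M.1 : Submodule ℤ B), M.1.2.units_smul b⟩,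
        units_smul_mono b M.2.1, ?_, ?_⟩
      invFun := fun M => ⟨⟨b⁻¹ • (M.1 : Submodule ℤ B), M.1.2.units_smul b⁻¹⟩, ?_, ?_, ?_⟩
      left_inv := fun M => Subtype.ext (Subtype.ext (inv_smul_smul b (M.1 : Submodule ℤ B)))
      right_inv := fun M => Subtype.ext (Subtype.ext (smul_inv_smul b (M.1 : Submodule ℤ B))) }
  · rw [relIndex_units_smul]
    exact M.2.2.1
  · rw [RightIdealClass.mk_units_smul]
    exact M.2.2.2
  · have := units_smul_mono b⁻¹ M.2.1
    rwa [inv_smul_smul] at this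
  · have := relIndex_units_smul b⁻¹ (M.1 : Submodule ℤ B) (b • I)
    rw [inv_smul_smul] at this
    rw [this]
    exact M.2.2.1
  · rw [RightIdealClass.mk_units_smul]
    exact M.2.2.2

/-- The unit groups of the left orders of `I` and `b I` are conjugate, hence equinumerous:
the weights do not depend on the representative. [folklore] -/
theorem card_stabilizer_units_smul (b : Bˣ) (I : Submodule ℤ B) :
    Nat.card (MulAction.stabilizer Bˣ (b • I)) = Nat.card (MulAction.stabilizer Bˣ I) := by
  rw [MulAction.stabilizer_smul_eq_stabilizer_map_conj]
  exact Subgroup.card_map_of_injective (MulAut.conj b).injective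

end Transport

section TransportOfOrder

variable {B : Type u} [Ring B] [Algebra ℚ B] [IsQuaternionAlgebra ℚ B] {O : Submodule ℤ B}

/-- The representative of the class of `I` is a translate `b I`. [folklore] -/
theorem RightIdealClass.exists_rep_mk_eq {B : Type u} [Ring B] {O : Submodule ℤ B}
    (I : invertibleRightIdeals O) :
    ∃ b : Bˣ, RightIdealClass.rep (RightIdealClass.mk I) = b • (I : Submodule ℤ B) :=
  RightIdealClass.mk_eq_mk_iff.mp
    ((RightIdealClass.mk_rep (RightIdealClass.mk I)).trans (by rfl)).symm

/-- **Brandt matrices may be computed on any representative**: for an invertible right `O`-ideal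
`I`, `T(n)_{[I] j} = #{M ⊆ I : [I : M] = n², [M] = j}`. [folklore] -/
theorem BrandtData.ofOrder_T_mk (hO : IsZOrder O) (I : invertibleRightIdeals O) (n : ℕ)
    (j : RightIdealClass O) :
    (BrandtData.ofOrder O hO).T n (RightIdealClass.mk I) j = subidealCount O I n j := by
  obtain ⟨b, hb⟩ := RightIdealClass.exists_rep_mk_eq I
  rw [BrandtData.ofOrder_T, hb, subidealCount_units_smul]

/-- **Weights may be computed on any representative**: `w_{[I]} = |O_ℓ(I)ˣ| / 2`. [folklore] -/
theorem BrandtData.ofOrder_w_mk (hO : IsZOrder O) (I : invertibleRightIdeals O) :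
    (BrandtData.ofOrder O hO).w (RightIdealClass.mk I) =
      Nat.card (MulAction.stabilizer Bˣ (I : Submodule ℤ B)) / 2 := by
  obtain ⟨b, hb⟩ := RightIdealClass.exists_rep_mk_eq I
  rw [BrandtData.ofOrder_w, hb, card_stabilizer_units_smul]

end TransportOfOrder

/-! ### Eichler packages and the Brandt module of level `(N⁺, N⁻)` -/

/-- An **Eichler package of level `(N⁺, N⁻)`**: a definite quaternion algebra `B` over `ℚ`
ramified at exactly the finite places `v` with `N⁻ ∈ v` (the primes dividing `N⁻`; so
`disc B = rad N⁻`, `= N⁻` for `N⁻` squarefree) and at `∞` (`IsTotallyDefinite`), together with an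
Eichler order `O ⊆ B` of level `N⁺`. Such a package exists iff `N⁺ ≥ 1`, `ω(rad N⁻)` is odd
(parity of ramification, `even_card_ramified_rat`; existence of `B`:
`exists_isQuaternionAlgebra_of_even_rat`) and `gcd(N⁺, N⁻) = 1` (an Eichler order is maximal at
the ramified primes); `B` is then unique up to isomorphism and `O` up to local conjugacy
(Vignéras III §3 Thm. 3.1, III §5). [cite: VignerasLNM800, Ch. III §3 Thm. 3.1 and §5 (ordres d'Eichler de niveau N)] -/
structure EichlerPackage (Nplus Nminus : ℕ) : Type 1 where
  /-- The quaternion algebra. -/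
  B : Type
  /-- `B` is a ring. -/
  [instRing : Ring B]
  /-- `B` is a `ℚ`-algebra. -/
  [instAlgebra : Algebra ℚ B]
  /-- `B` is a quaternion algebra over `ℚ`. -/
  [instIsQuaternionAlgebra : IsQuaternionAlgebra ℚ B]
  /-- `B` is definite (ramified at `∞`). -/
  isTotallyDefinite : IsTotallyDefinite ℚ B
  /-- `B` is ramified exactly at the primes dividing `N⁻`. -/
  mem_ramifiedPlaces_iff :
    ∀ v : HeightOneSpectrum (𝓞 ℚ), v ∈ ramifiedPlaces ℚ B ↔ ((Nminus : ℕ) : 𝓞 ℚ) ∈ v.asIdeal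
  /-- The Eichler order. -/
  O : Submodule ℤ B
  /-- `O` is an Eichler order of level `N⁺`. -/
  isEichlerOrder : IsEichlerOrder O Nplus

namespace EichlerPackage

variable {Nplus Nminus : ℕ}

/-- The algebra of an Eichler package is a ring (the bundled instance, re-exposed). [folklore] -/
instance instRingB (P : EichlerPackage Nplus Nminus) : Ring P.B := P.instRing

/-- The algebra of an Eichler package is a `ℚ`-algebra (the bundled instance, re-exposed). [folklore] -/
instance instAlgebraB (P : EichlerPackage Nplus Nminus) : Algebra ℚ P.B := P.instAlgebra

/-- The algebra of an Eichler package is a quaternion algebra over `ℚ` (the bundled instance,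
re-exposed). [folklore] -/
instance instIsQuaternionAlgebraB (P : EichlerPackage Nplus Nminus) : IsQuaternionAlgebra ℚ P.B :=
  P.instIsQuaternionAlgebra

/-- The Brandt data `(Cls O, w, B(·))` of an Eichler package. [folklore] -/
def brandtData (P : EichlerPackage Nplus Nminus) : BrandtData.{0} :=
  BrandtData.ofOrder P.O P.isEichlerOrder.isZOrder

/-- The index type of the Brandt data of a package is the class set of its Eichler order
(definitional). [folklore] -/
@[simp] theorem brandtData_ι (P : EichlerPackage Nplus Nminus) :
    P.brandtData.ι = RightIdealClass P.O := rfl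

end EichlerPackage

/-- **The Brandt module of level `(N⁺, N⁻)`** (H. Brandt, Jber. DMV 53 (1943); Eichler 1973
II §6; Pizer 1980 §2; Gross 1987 §1): the Brandt data — class set `Cls O`, weights `w_i = |O_ℓ(I_i)ˣ| / 2`, Brandt
matrices `B(n)_ij = #{M ⊆ I_i : [I_i : M] = n², [M] = [I_j]}` — of an Eichler order `O` of level
`N⁺` in a definite quaternion algebra over `ℚ` of discriminant `N⁻`, for *some* Eichler package of
level `(N⁺, N⁻)` chosen once and for all by `Classical.choice`; the junk value `BrandtData.empty`
if there is none (`ω(rad N⁻)` even, `N⁺ = 0`, or `gcd(N⁺, N⁻) > 1`). Intended use: `N⁺ ≥ 1` and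
`N⁻` squarefree with an odd number of prime factors, coprime (route `ABC/DefiniteXi`). The result
depends on the choices only up to isomorphism of Brandt data (all Eichler orders of a given level
are locally conjugate and linked by an ideal, Vignéras III §5 Cor. 5.5 ff.), to be recorded as a
theorem; use `brandtModule_eq` to access the chosen package. [cite: Eichler1973, Ch. II §6 (15) and Thm. 2] -/
def brandtModule (Nplus Nminus : ℕ) : BrandtData.{0} := by
  classical
  exact if h : Nonempty (EichlerPackage Nplus Nminus) then (Classical.choice h).brandtData
    else BrandtData.empty

/-- The Eichler package underlying `brandtModule N⁺ N⁻` when one exists (by choice). [folklore] -/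
def brandtPackage (Nplus Nminus : ℕ) (h : Nonempty (EichlerPackage Nplus Nminus)) :
    EichlerPackage Nplus Nminus :=
  Classical.choice h

/-- `brandtModule N⁺ N⁻` is the Brandt data of the chosen Eichler package, when one exists. [folklore] -/
theorem brandtModule_eq {Nplus Nminus : ℕ} (h : Nonempty (EichlerPackage Nplus Nminus)) :
    brandtModule Nplus Nminus = (brandtPackage Nplus Nminus h).brandtData := by
  unfold brandtModule brandtPackage
  exact dif_pos h

/-- At inadmissible levels (no Eichler package) `brandtModule` is the empty junk data. [folklore] -/
theorem brandtModule_eq_empty {Nplus Nminus : ℕ} (h : ¬ Nonempty (EichlerPackage Nplus Nminus)) :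
    brandtModule Nplus Nminus = BrandtData.empty := by
  unfold brandtModule
  exact dif_neg h

/-- The index set of `brandtModule N⁺ N⁻` is the class set of the chosen Eichler order, when a
package exists. [folklore] -/
theorem brandtModule_ι {Nplus Nminus : ℕ} (h : Nonempty (EichlerPackage Nplus Nminus)) :
    (brandtModule Nplus Nminus).ι = RightIdealClass (brandtPackage Nplus Nminus h).O := by
  rw [brandtModule_eq h]
  rfl

/-! ### Classical properties of Brandt matrices (named facts) -/

section Facts

/-- **Existence of Eichler packages at admissible levels**: for `N⁺ ≥ 1` and `N⁻` squarefree
with an odd number of prime factors and coprime to `N⁺`, there is a definite quaternion algebra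
over `ℚ` ramified exactly at the primes dividing `N⁻` containing an Eichler order of level `N⁺` —
so that `brandtModule N⁺ N⁻` is not the junk value. Ingredients, all in Vignéras: the quaternion
algebra exists by the classification III §3 Thm. 3.1 (`|Ram| = ω(N⁻) + 1` even; in the tree this
half is the theorem `exists_isQuaternionAlgebra_of_even_rat`, up to the dictionary between
`HeightOneSpectrum (𝓞 ℚ)` and rational primes); maximal orders exist (I §4 Prop. 4.2); an Eichler
order of level `N⁺` is obtained from a maximal order `O₁` by replacing `O₁,p`, `p ∣ N⁺`, by the
local Eichler order of level `p^{v_p(N⁺)}` inside it (II §2 Déf. and Lemme 2.4) via the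
local–global correspondence for lattices (III §5 Prop. 5.1: being an Eichler order is a local
property). [cite: VignerasLNM800, Ch. III §3 Thm. 3.1, Ch. I §4 Prop. 4.2, Ch. II §2 Lemme 2.4, Ch. III §5 Prop. 5.1] -/
def nonempty_eichlerPackage : Prop :=
  ∀ Nplus Nminus : ℕ, 0 < Nplus → Squarefree Nminus → Odd Nminus.primeFactors.card →
    Nat.Coprime Nplus Nminus → Nonempty (EichlerPackage Nplus Nminus)

/-- At admissible levels the Brandt module is the Brandt data of an Eichler package (given the
existence fact `nonempty_eichlerPackage`). [folklore] -/
theorem brandtModule_eq_of_admissible (h : nonempty_eichlerPackage) {Nplus Nminus : ℕ}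
    (h0 : 0 < Nplus) (hsq : Squarefree Nminus) (hodd : Odd Nminus.primeFactors.card)
    (hcop : Nat.Coprime Nplus Nminus) :
    brandtModule Nplus Nminus =
      (brandtPackage Nplus Nminus (h Nplus Nminus h0 hsq hodd hcop)).brandtData :=
  brandtModule_eq _

/-- **Eichler's mass formula** for the Brandt module of level `(N⁺, N⁻)` over `ℚ`: for `N⁺ ≥ 1`
and `N⁻` squarefree with an odd number of prime factors, coprime to `N⁺`,
`∑_i 1 / w_i = (1/12) · ∏_{q ∣ N⁻} (q - 1) · ∏_{p^k ∥ N⁺} p^{k-1} (p + 1)`.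
This is Vignéras V §2 Cor. 2.3 — for a totally definite `H/K` and an Eichler order of level `N`,
`∑ w_i⁻¹ = 2^{1-n} |ζ_K(-1)| h_K · 𝐍(N) ∏_{p ∣ D} (𝐍p - 1) ∏_{p ∣ N} (𝐍p⁻¹ + 1)` with
`w_i = [O_iˣ : Rˣ]` — at `K = ℚ` (`n = 1`, `h = 1`, `ζ(-1) = -1/12`, `[O_iˣ : ℤˣ] = |O_iˣ| / 2`);
Vignéras' `O_i` are the right orders of left-ideal representatives, the mirror image of the left
orders of right ideals used here. Stated for every Eichler package (the weights of
`brandtModule N⁺ N⁻` are those of `brandtPackage`). [cite: VignerasLNM800, Ch. V §2 Cor. 2.3 (formule de masse d'Eichler)] -/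
def brandtModule_massFormula : Prop :=
  ∀ (Nplus Nminus : ℕ) (P : EichlerPackage Nplus Nminus), 0 < Nplus → Squarefree Nminus →
    ∑ i : P.brandtData.ι, (1 : ℚ) / P.brandtData.w i =
      (1 / 12 : ℚ) * (∏ q ∈ Nminus.primeFactors, ((q : ℚ) - 1)) *
        ∏ p ∈ Nplus.primeFactors, (p : ℚ) ^ (Nplus.factorization p - 1) * ((p : ℚ) + 1)

/-- **Multiplicativity of Brandt matrices**: `B(m n) = B(m) B(n)` for coprime `m, n`, at every
level. Printed sources: Vignéras III §5 exercice 5.8 (c), p. 100, stated for "un ordre d'Eichler"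
`O` of a quaternion algebra over a number field, of any level `N`: "Loi de multiplication pour
`P(A)`: `P(A) P(B) = P(AB)` si `(A, B) = 1`" (no restriction on `A, B` relative to `D N`);
Eichler 1973, II §6 Thm. 2 (18), `B_l(n₁) B_l(n₂) = B_l(n₁ n₂)` for `(n₁, n₂) = 1`, printed for
level `D H` with `H` squarefree, the proof ((23): unique factorisation of an integral ideal of
norm `n₁ n₂` into integral ideals of norms `n₁`, `n₂`) being level-free. In the sub-ideal form
used here: a sub-ideal `M ⊆ I_i` of index `(m n)²` contains a unique intermediate invertible
sub-ideal of index `m²` (coprimality), whence `T(mn)_{ik} = ∑_j T(m)_{ij} T(n)_{jk}`. [cite: VignerasLNM800, Ch. III §5 exercice 5.8 (c), p. 100] -/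
def brandtMatrix_mul_of_coprime : Prop :=
  ∀ (Nplus Nminus : ℕ) (P : EichlerPackage Nplus Nminus) (m n : ℕ), Nat.Coprime m n →
    P.brandtData.T (m * n) = P.brandtData.T m * P.brandtData.T n

/-- **Brandt matrices prime to the level commute**: `B(m) B(n) = B(n) B(m)` for `m, n` coprime
to `N⁺ N⁻`. Printed sources: Vignéras III §5 exercice 5.8, p. 100, for "un ordre d'Eichler" `O`
(any level `N`, `D` the discriminant): "(c) Loi de multiplication pour `P(A)`:
`P(A) P(B) = P(AB)` si `(A, B) = 1`; … `P(p^a) P(p^b) = ∑_{n=0}^{b} N(p)^n P(p^{a+b-2n}) L(p⁻¹)^n`,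
`a ≥ b`, si `(p, DN) = 1`" (over `ℚ` the permutation matrices `L(p⁻¹)` of the principal ideals
`(p⁻¹)` are the identity) and "(d) Les matrices de Brandt et les matrices de permutation
engendrent une `R`-algèbre commutative"; Eichler 1973, II §6 Thm. 2 (18)–(19) (level `D H`,
`H` squarefree): multiplicativity and the Hecke recursion at `p ∤ D H`, "they generate a
semisimple commutative ring". For `m, n` prime to `N⁺ N⁻` commutativity follows from (c) alone
(coprime multiplicativity, and each `B(p^a)`, `p ∤ N⁺N⁻`, is a polynomial in `B(p)`); the
operators `B(p^a)` at `p ∣ N⁺` (the `U_p`-type operators, not covered by (c)) are deliberately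
excluded — this is also the generality the route asks for (`T_n`, `gcd(n, N⁺N⁻) = 1`). [cite: VignerasLNM800, Ch. III §5 exercice 5.8 (c)–(d), p. 100] -/
def brandtMatrix_comm : Prop :=
  ∀ (Nplus Nminus : ℕ) (P : EichlerPackage Nplus Nminus) (m n : ℕ),
    Nat.Coprime m (Nplus * Nminus) → Nat.Coprime n (Nplus * Nminus) →
      P.brandtData.T m * P.brandtData.T n = P.brandtData.T n * P.brandtData.T m

/-- **Weight symmetry of Brandt matrices** (self-adjointness of the Hecke correspondences for the
height pairing): `w_j B(n)_ij = w_i B(n)_ji`. Eichler 1973, II §6 Thm. 2 (17) with `l = 0`: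
`B(n)ᵀ = diag(e_i)⁻¹ B(n) diag(e_i)`, `e_i = |O_iˣ| = 2 w_i`, printed for Eichler's orders of
level `D H` with `H` squarefree; the printed proof (passage to conjugate ideals, (21)–(22)) uses
only local principality and is the general argument (Gross 1987 §§1–2 for `N⁺ = 1`;
Pollack–Weston 2011 §2.1 at level `(N⁺, N⁻)`). Vendored at every level `(N⁺, N⁻)`. [cite: Eichler1973, Ch. II §6 Thm. 2 eq. (17)] -/
def brandtMatrix_weight_symm : Prop :=
  ∀ (Nplus Nminus : ℕ) (P : EichlerPackage Nplus Nminus) (n : ℕ) (i j : P.brandtData.ι),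
    (P.brandtData.w j : ℤ) * P.brandtData.T n i j = (P.brandtData.w i : ℤ) * P.brandtData.T n j i

/-- The weight symmetry makes Gross's Hecke correspondence `t_n` self-adjoint for the height
pairing: `⟨t_n v, v'⟩ = ⟨v, t_n v'⟩` (consequence of `brandtMatrix_weight_symm`, proved). [folklore] -/
theorem brandtMatrix_weight_symm.pairing_hecke (h : brandtMatrix_weight_symm)
    {Nplus Nminus : ℕ} (P : EichlerPackage Nplus Nminus) (n : ℕ) (v v' : P.brandtData.ι → ℤ) :
    P.brandtData.pairing (P.brandtData.hecke n v) v' =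
      P.brandtData.pairing v (P.brandtData.hecke n v') := by
  simp only [BrandtData.pairing, BrandtData.hecke_apply, Matrix.mulVec, dotProduct,
    Matrix.transpose_apply, Finset.mul_sum, Finset.sum_mul]
  conv_lhs => rw [Finset.sum_comm]
  refine Finset.sum_congr rfl fun i _ => Finset.sum_congr rfl fun j _ => ?_
  -- termwise this is `w_j T(n)_ij = w_i T(n)_ji`
  have hs := h Nplus Nminus P n i j
  calc (P.brandtData.w j : ℤ) * (P.brandtData.T n i j * v i) * v' j
      = ((P.brandtData.w j : ℤ) * P.brandtData.T n i j) * v i * v' j := by ring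
    _ = ((P.brandtData.w i : ℤ) * P.brandtData.T n j i) * v i * v' j := by rw [hs]
    _ = (P.brandtData.w i : ℤ) * v i * (P.brandtData.T n j i * v' j) := by ring

end Facts

end Literature.NumberTheory.Automorphic
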